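import Summits.Parity.BatemanHorn.Theorems.AlmostPrimeZerosDefs
import Literature.NumberTheory.LFunctions.LevinFainleibTauberian
import HarnessLib

/-!
# Route `AlmostPrimeZeros`, crux `SystemLSDRealSegment` (stmt-Parity-11292), line
# `beta-thinned-root-kernel`: the registered stub `stub_levinFainleib`

The stub `stub_levinFainleib : ∀ g κ, LevinFainleibAsymp g κ` of the checked skeleton of the line
`beta-thinned-root-kernel` is the logarithmic mean-value theorem for non-negative multiplicative
functions with prime mean `κ` (Levin–Faĭnleĭb 1967 / Halberstam–Richert 1974, Lemma 5.4 / Wirsing),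
in asymptotic form with the constant identified as the ordered Euler product
`P = ∏_p (∑_ν g(p^ν)) (1 − 1/p)^κ`.  It is a pure statement about a real sequence and is PROVED in
the Literature tree as
`Literature.NumberTheory.LFunctions.LevinFainleib.levinFainleib_asymp`
(`Literature/NumberTheory/LFunctions/LevinFainleibTauberian.lean`, with its supporting files
`LevinFainleibPrimeSums`, `LevinFainleibLocalFactors`, `LevinFainleibProduct`,
`LevinFainleibDirichlet`): Abel summation with Mertens' first theorem, the Euler product of
`∑ g(n) n^{-s}` against `ζ(1+s)^κ`, and the tree's Hardy–Littlewood–Karamata Tauberian theorem for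
Dirichlet series (`HardyLittlewoodTauberianDirichlet_holds`).  This file only unfolds the
predicate `LevinFainleibAsymp` (`AlmostPrimeZerosDefs.lean`) and applies that theorem.
-/

namespace Summit.Parity.BatemanHorn.Cruxes.SystemLSDRealSegment.BetaThinnedRootKernel

/-- **Registered stub `stub_levinFainleib`** of line `beta-thinned-root-kernel` (crux
`SystemLSDRealSegment`, stmt-Parity-11292): the Levin–Faĭnleĭb / Halberstam–Richert Lemma 5.4
mean-value theorem in asymptotic form, `LevinFainleibAsymp g κ` for every real sequence `g` and
every real `κ` — discharged by the Literature theorem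
`Literature.NumberTheory.LFunctions.LevinFainleib.levinFainleib_asymp`.
[cite: HalberstamRichert1974, Lemma 5.4] -/
theorem stub_levinFainleib : ∀ (g : ℕ → ℝ) (κ : ℝ), LevinFainleibAsymp g κ :=
  fun g κ hκ hg0 hg1 hmul h1 h2 =>
    Literature.NumberTheory.LFunctions.LevinFainleib.levinFainleib_asymp g κ hκ hg0 hg1 hmul h1 h2

end Summit.Parity.BatemanHorn.Cruxes.SystemLSDRealSegment.BetaThinnedRootKernel
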